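import Mathlib
import Literature.Analysis.FluidPDE.Tao2016AveragedNS.RestartedCascadeFlows
import Summits.NavierStokesRegularity.NavierStokesRegularity.Theses.TaoLadderRungThree
import Summits.NavierStokesRegularity.NavierStokesRegularity.Theorems.TaoLadderRungThreeGappedFrontRobustV2
import HarnessLib

/-!
# `HeteroclinicTriggerChain` — crux `TriggerChainFrontStep` (item stmt-NavierStokesRegularity-22785):
  registered stub `stub_gapped_front_robust_v2` of line `gapdata_v2`

The third stub of the lead's registered skeleton (`Cruxes/TriggerChainFrontStep/Lines/gapdata_v2.lean`,
sha `2678b3af756f`) is, verbatim, the host route's universal robustness theorem K_B₂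
`Summit.NavierStokesRegularity.NavierStokesRegularity.Theses.TaoLadderRungThree.GappedFrontRobustV2`
(item stmt-NavierStokesRegularity-22114): format-v2 gap data `GapData₂ σ ε₀ i₀ α X₀ Z w r ρ θ₀ θ c₀ c env₀` for an
`R`-comparable table plus the thin-tail clause yield a margin `η > 0` and an epoch envelope `env` with
`FrontExists` and `RobustStep` for the ball description `ballDesc Z w r`. That item is PROVED in the tree
(`Theorems/TaoLadderRungThreeGappedFrontRobustV2.lean`,
`…Cruxes.GappedFrontRobustV2.ThreeZone.GappedFrontRobustV2_of`, cell h2-tao-ladder, three-zone proof), so the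
stub is discharged here by that theorem; the composition `TriggerChainFrontStep_of` of the skeleton then needs
only `stub_chain_gap_of_normal_form` (the analytic `GapData₂` certificate of the unfolded chain).

HONEST FRAMING: MODEL-lattice statement in the vocabulary of Tao 2016 §4/§6 (`RestartedCascadeFlows`); nothing
here is about the Navier–Stokes equations; no summit, rung or crux is proved by this file — it records that one
registered stub of an OPEN crux is already a theorem of the tree.
-/

noncomputable section

-- the sub-problem namespace repeats the summit name by design (D-0017)
set_option linter.dupNamespace false

namespace Summit.NavierStokesRegularity.NavierStokesRegularity.Theorems.HeteroclinicTriggerChain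

/-- Registered stub `stub_gapped_front_robust_v2` of crux `TriggerChainFrontStep` (stmt-22785), line
`gapdata_v2`: for every `R`-comparable symmetric cancelling table `α`, scale ratio `1 + ε₀ > 1`, format-v2 gap
data `GapData₂ σ ε₀ i₀ α X₀ Z w r ρ θ₀ θ c₀ c env₀` and the thin-tail clause
`∀ ϑ > 0, ∃ k₂, ∀ k ≥ k₂, (1+ε₀)^{5(k+2)/2} · r · w (k+1) ≤ ϑ · (w k)²`, there are `η > 0` and `env` with
`FrontExists ε₀ θ c η α (ballDesc Z w r) env` and `RobustStep ε₀ θ c η i₀ α (ballDesc Z w r) env`.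
This is literally the host item K_B₂ `TaoLadderRungThree.GappedFrontRobustV2`, proved in
`Theorems/TaoLadderRungThreeGappedFrontRobustV2.lean`; we re-export it under the stub's registered name.
[cite: Tao2016AveragedNS, §6.3–6.4 Props. 6.4–6.5 (statement shape)] -/
theorem stub_gapped_front_robust_v2 : ∀ (R σ ε₀ : ℝ) (i₀ : Fin 4) (α : Fin 4 → Fin 4 → Fin 4 → ℤ × ℤ × ℤ → ℝ) (X₀ : Fin 4 → ℝ) (Z : Set (Fin 4 → ℤ → ℝ)) (w : ℤ → ℝ) (r ρ θ₀ θ c₀ c : ℝ) (env₀ : ℤ → ℝ), Literature.Analysis.FluidPDE.TaoCascade.InTableClass R α → 0 < ε₀ → Literature.Analysis.FluidPDE.TaoCascade.GapData₂ σ ε₀ i₀ α X₀ Z w r ρ θ₀ θ c₀ c env₀ → (∀ ϑ : ℝ, 0 < ϑ → ∃ k₂ : ℤ, ∀ k : ℤ, k₂ ≤ k → (1 + ε₀) ^ ((5 : ℝ) * (k + 2) / 2) * r * w (k + 1) ≤ ϑ * w k ^ 2) → ∃ (η : ℝ) (env : ℤ → ℝ), 0 < η ∧ Literature.Analysis.FluidPDE.TaoCascade.FrontExists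 ε₀ θ c η α (Literature.Analysis.FluidPDE.TaoCascade.ballDesc Z w r) env ∧ Literature.Analysis.FluidPDE.TaoCascade.RobustStep ε₀ θ c η i₀ α (Literature.Analysis.FluidPDE.TaoCascade.ballDesc Z w r) env :=
  Summit.NavierStokesRegularity.NavierStokesRegularity.Cruxes.GappedFrontRobustV2.ThreeZone.GappedFrontRobustV2_of

end Summit.NavierStokesRegularity.NavierStokesRegularity.Theorems.HeteroclinicTriggerChain

end
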